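import Summits.QuantumFields.BalabanUV.Beta.GAN24.Entry110GDivFlat
import Summits.QuantumFields.BalabanUV.Beta.GAN24.Entry110GradCubic

/-!
# G-an2-4 ∕ (CONV-C), INTERFACE REQUEST (B5-1115-TABLE), item (E3), step 2: [B5] (1.110) THIRD ENTRY «|(G∇*J)(x)| ≤ O(1)e^{−δ₀|y−y′|}|J|»
# for `G = Δ_1⁻¹ = (DeltaA n M 1)⁻¹` AT `U = 1`, `a = 1`, ON EVERY CUBIC UNIT TORUS, UNIFORMLY IN THE SPACING — transported from the
# NE3 carrier (step 1, `GAN24/Entry110GDivFlat`) to Bałaban's fine torus, and the general reduction behind the named statement `Entry110GDiv`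

G-an2-4 formalisation swarm `b2b-balaban-gan24-formalise-*`, leaf prover 04 (gen 46), crux team (2) under the coordinator ruling
«YM REDIRECT» (e34b3e0c); toward the road-P2 crux prover's **INTERFACE REQUEST G-an2-4: (B5-1115-TABLE)** (unit `b2b-balaban-gan24-p2`
gen 28, `HOME/INBOX.md` 2026-08-21T05:44Z) item **(E3)**, typed by leaf 01 (gen 53) as `B5Prop12Entries110.Entry110GDiv d a` (p250927;
quantified over EVERY torus `M`).  The kernel of `G·∇_ν^*` (`∇_ν^* = (fdiff (fine n M) n ν)ᴴ`) is the COLUMN difference of the kernel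
of `G`: `(G·∇_ν^*)(i,x′) = n·(G(i,(x′₁+e_ν,x′₂)) − G(i,x′))` (§1); step 1 bounded the cube sums in the column variable of the
column-differenced flat propagator on the NE3 carrier (`Entry110GDivFlat.cubeSum_gFlat_mul_colDiff_le`); THIS FILE is the dictionary +
transport (the pattern of t4-ne2-formalise-leaf-05's `GradientRowSumTransport` §3 for the second entry) and the (1.110) sup entry:
 * §1 `mul_shiftM_conjTranspose_apply`, `mul_fdiff_conjTranspose_apply` (`(A·∇_ν^*)(i,j) = c̄·(A(i,(j₁+e_ν,j₂)) − A(i,j))`),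
   `norm_DeltaA_inv_mul_fdiffH_apply` (realness of `Δ_a⁻¹`), **`abs_gFlat_mul_colDiff_eq`**:
   `|(gFlat j·colDiff ν)(p,q)| = L^{min(j,k)}·‖(Δ_1⁻¹·∇_ν^*)(eF p, eF q)‖`;
 * §2 **`block_row_sum_inv_fdiffH_le`**: from ANY constants `(B₂, δ ≥ 0)` satisfying step 1's column statement, for `j ≤ k`, every
   direction `ν`, every row `i` and every block `y′` of `Tor (fine (side k L j) (Mlev d k N L j))`:
   `Σ_{x′ : blockOf x′ = y′} ‖(Δ_1⁻¹·∇_ν^*)(i,x′)‖ ≤ B₂·e^{−δ·|blockOf(i) − y′|_{T₁,∞}}` — UNIFORM in the lattice spacing;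
 * §3 **`entry110GDiv_of_block_row_sum`** (ANY `a`): such a per-block bound on EVERY torus IMPLIES the named `Entry110GDiv d a`
   (`G (∇^* J) = (G·∇^*) J` and `Entry110GradCubic.norm_mulVec_bpt_le_of_block_row_sum`) — what remains for the named Prop is the
   rectangular case;
 * §4 `block_row_sum_inv_fdiffH_le_cubic` — packaged for every spacing `n ≥ 1` and every CUBIC unit torus (witness
   `(k,N,L,j) = (1,N₀,n,1)`);
 * §5 END **`entry110GDiv_one_cubic`**: the BODY of `Entry110GDiv d 1` VERBATIM at `M := fun _ => N₀`: `∃ δ₀ C > 0` (functions of `d`)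
   with, for every `n ≥ 1`, `N₀ ≥ 1`, `ν`, `y, y′`, `J` supported in `B(y′)` with `|J| ≤ B`, `x = n·y + r ∈ B(y)`, `μ`:
   `‖(Δ_1⁻¹ (∇_ν^* J))_μ(x)‖ ≤ C·e^{−δ₀·|y − y′|_{T₁,∞}}·B`.

HONEST SCOPE.  (i) `a = 1`, `U = 1`.  (ii) CUBIC unit tori only — the named Prop `Entry110GDiv d 1` (∀ `M`) is NOT discharged; its
rectangular case needs a rectangular-torus free heat-kernel chain or a covering ∕ periodisation bridge for `DeltaA⁻¹` (located, not claimed;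
§3 records what is missing).  (iii) The fourth entry `ΔG` and the Hölder entries are untouched.  (iv) Unit cubes `B` for the printed `Δ̃`.
(v) Constants are NE3's existential `(B₂, δ)(d)`; nothing printed is asserted — [B5] `Balaban1984PropagatorsI` p. 35 (1.110) is a TEXT
LOCATION; the analysis is t4-ne3-p1's, the block resummation pv15's; step 1 added one transpose and one reflection, this file the
dictionary.  No `def`, no `def … : Prop`, no `sorry`.  NOT (CONV-C), NEVER «G-an2-4 closed», NOT NE2 ∕ NE3, NOT D1, NOT BetaPertH, NOT
continuum, NOT Clay; not in print — our bookkeeping.  ABSOLUTE RULE of the cell kept.  HONEST DEPENDENCY: continuum YM on T⁴ ⇐ BetaPertH ∧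
nine spine estimates (0/9 proved); BetaPertH ⇐ (D1) ∧ (D4) ∧ CAP+tail; G-an2-4 gates asym, D1 and NE2/3/4.
-/

noncomputable section

open scoped BigOperators ComplexConjugate Matrix
open Finset

namespace Summit.QuantumFields.BalabanUV.Beta.GAN24.Entry110GDivCubic

open Literature.MathematicalPhysics.QuantumFieldTheory.Balaban1983to89
open Literature.MathematicalPhysics.QuantumFieldTheory.Balaban1983to89.TreeLengthTorus (TPt)
open B5Prop11Plancherel (Tor fine unitVec shiftM fdiff)
open B5Block118 (bpt)
open B5Blocks16 (blockOf blockOf_bpt)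
open B6LowerBound2153Torus (toT rep)
open B5DeltaA169 (DeltaA)
open B5RealFields (isReal_DeltaA_inv)
open B4TorusKernel.MultiPeriod (torusSupNorm torusSupNorm_nonneg)
open B5Prop12Entries110 (Entry110GDiv)
open Summit.QuantumFields.BalabanUV.T4Continuum
open SliceTorusBlocks SliceTorusTower SliceCovariantTower SliceFlatPropagator SliceFlatFreeResolvent SliceFlatGradientPrep
open SliceFlatGradient GradientRowSumTransport Entry110GDivFlat Entry110GradCubic

variable {d : ℕ}

/-! ## §1 Entries of `A·∇_ν^*`; NE3's column difference of `gFlat` IS `L^{min(j,k)}·(Δ_1⁻¹·∇_ν^*)` read through `eF` -/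

section Dictionary

variable (Nf : Fin d → ℕ) [∀ μ, NeZero (Nf μ)]

/-- `(A·S_νᴴ)(i,j) = A(i,(j₁+e_ν,j₂))`: right multiplication by the adjoint shift shifts the COLUMN index. [folklore] -/
theorem mul_shiftM_conjTranspose_apply {ι : Type*} (ν : Fin d) (A : Matrix ι (Tor Nf × Fin d) ℂ) (i : ι) (j : Tor Nf × Fin d) :
    (A * (shiftM Nf ν)ᴴ) i j = A i (j.1 + unitVec Nf ν, j.2) := by
  rw [Matrix.mul_apply, Finset.sum_eq_single (j.1 + unitVec Nf ν, j.2)]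
  · simp [shiftM, Matrix.conjTranspose_apply]
  · intro m _ hm
    simp [shiftM, Matrix.conjTranspose_apply, hm]
  · intro h; exact absurd (Finset.mem_univ _) h

/-- **`(A·∇_νᴴ)(i,j) = c̄·(A(i,(j₁+e_ν,j₂)) − A(i,j))`**: right multiplication by the adjoint forward difference differences the
COLUMN index. [folklore] -/
theorem mul_fdiff_conjTranspose_apply {ι : Type*} (c : ℂ) (ν : Fin d) (A : Matrix ι (Tor Nf × Fin d) ℂ) (i : ι)
    (j : Tor Nf × Fin d) :
    (A * (fdiff Nf c ν)ᴴ) i j = starRingEnd ℂ c * (A i (j.1 + unitVec Nf ν, j.2) - A i j) := by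
  rw [fdiff, Matrix.conjTranspose_smul, Matrix.conjTranspose_sub, Matrix.conjTranspose_one, Matrix.mul_smul, Matrix.mul_sub,
    Matrix.mul_one, Matrix.smul_apply, Matrix.sub_apply, mul_shiftM_conjTranspose_apply, smul_eq_mul, starRingEnd_apply]

variable (n : ℕ) [NeZero n] (M : Fin d → ℕ) [∀ μ, NeZero (M μ)]

/-- the entries of `Δ_a⁻¹·∇_ν^*` are `n·|Re G(i,(j₁+e_ν,j₂)) − Re G(i,j)|` in modulus (`G = Δ_a⁻¹` is a REAL matrix, pv15's
`B5RealFields.isReal_DeltaA_inv`). [folklore] -/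
theorem norm_DeltaA_inv_mul_fdiffH_apply (a : ℝ) (ν : Fin d) (i j : Tor (fine n M) × Fin d) :
    ‖((DeltaA n M a)⁻¹ * (fdiff (fine n M) (n : ℂ) ν)ᴴ) i j‖
      = (n : ℝ) * |((DeltaA n M a)⁻¹ i (j.1 + unitVec (fine n M) ν, j.2)).re - ((DeltaA n M a)⁻¹ i j).re| := by
  rw [mul_fdiff_conjTranspose_apply, Complex.conj_natCast]
  have h1 := (isReal_DeltaA_inv n M a).im_eq_zero i (j.1 + unitVec (fine n M) ν, j.2)
  have h2 := (isReal_DeltaA_inv n M a).im_eq_zero i j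
  have e : (DeltaA n M a)⁻¹ i (j.1 + unitVec (fine n M) ν, j.2) - (DeltaA n M a)⁻¹ i j
      = ((((DeltaA n M a)⁻¹ i (j.1 + unitVec (fine n M) ν, j.2)).re - ((DeltaA n M a)⁻¹ i j).re : ℝ) : ℂ) := by
    apply Complex.ext
    · simp
    · simp [h1, h2]
  rw [e, norm_mul, Complex.norm_natCast, Complex.norm_real, Real.norm_eq_abs]

end Dictionary

section Flat

variable (d k N L : ℕ) [NeZero N] [NeZero L]

/-- **NE3's COLUMN DIFFERENCE OF `gFlat j` IS `L^{min(j,k)}·(Δ_1⁻¹·∇_ν^*)` READ THROUGH `eF`**: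
`|(gFlat j·colDiff ν)(p,q)| = L^{min(j,k)}·‖((DeltaA (side k L j) (Mlev d k N L j) 1)⁻¹·(fdiff … ν)ᴴ)((eF p₁,p₂),(eF q₁,q₂))‖`. [folklore] -/
theorem abs_gFlat_mul_colDiff_eq (j : ℕ) (ν : Fin (d + 1)) (p q : TPt (d + 1) (N * L ^ k) × Fin (d + 1)) :
    |(gFlat d k N L j * colDiff d k N L ν) p q|
      = (side k L j : ℝ) * ‖((DeltaA (side k L j) (Mlev d k N L j) 1)⁻¹
          * (fdiff (fine (side k L j) (Mlev d k N L j)) (side k L j : ℂ) ν)ᴴ) (eF d k N L j p.1, p.2) (eF d k N L j q.1, q.2)‖ := by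
  rw [norm_DeltaA_inv_mul_fdiffH_apply, mul_colDiff_apply]
  simp only [gFlat]
  rw [SliceFlatStencil.eF_add, SliceFlatStencil.eF_single, ← mul_sub, abs_mul,
    abs_of_nonneg (by positivity : (0 : ℝ) ≤ (side k L j : ℝ) ^ 2)]
  ring

/-! ## §2 The transported per-block bound: (1.110), third entry, at `U = 1`, block row sums uniform in the spacing -/

/-- **(1.110), THIRD ENTRY `G∇*`, `U = 1`, `a = 1`, PER-BLOCK ROW SUMS, n-UNIFORM** — transported from step 1's column statement on
the NE3 carrier (any constants `B₂`, `δ ≥ 0` satisfying it): on Bałaban's fine torus `Tor (fine (side k L j) (Mlev d k N L j))`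
(`n = L^j` sites per block side, `N·L^{k−j}` blocks per direction, `j ≤ k`), for every direction `ν`, every row `i` and every block `y′`,
`Σ_{x′ : blockOf x′ = y′} ‖(Δ_1⁻¹·∇_ν^*)(i,x′)‖ ≤ B₂·e^{−δ·|blockOf(i) − y′|_{T₁,∞}}`.  (Location of the printed text: [B5]
`Balaban1984PropagatorsI` p. 35, (1.110), third entry; the typed inequality is not a quotation.) [folklore] -/
theorem block_row_sum_inv_fdiffH_le {B₂ δ : ℝ} (hδ : 0 ≤ δ)
    (hcol : ∀ (k N L : ℕ) [NeZero N] [NeZero L] (j : ℕ), j ≤ k →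
      ∀ (ν : Fin (d + 1)) (p : TPt (d + 1) (N * L ^ k) × Fin (d + 1)) (y₁ : TPt (d + 1) (levM k N L j)),
        ∑ q ∈ Finset.univ.filter (fun q => cubeI (d + 1) k N L (Fin (d + 1)) j q = y₁),
            |(gFlat d k N L j * colDiff d k N L ν) p q|
          ≤ B₂ * (L : ℝ) ^ j * Real.exp (-(δ * nbd (d + 1) k N L j (cubeI (d + 1) k N L (Fin (d + 1)) j p) y₁)))
    {j : ℕ} (hj : j ≤ k) (ν : Fin (d + 1)) (i : Tor (fine (side k L j) (Mlev d k N L j)) × Fin (d + 1))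
    (y' : TPt (d + 1) (levM k N L j)) :
    ∑ x' : Tor (fine (side k L j) (Mlev d k N L j)) × Fin (d + 1),
        (if blockOf (side k L j) (Mlev d k N L j) x'.1 = y' then
          ‖((DeltaA (side k L j) (Mlev d k N L j) 1)⁻¹
            * (fdiff (fine (side k L j) (Mlev d k N L j)) (side k L j : ℂ) ν)ᴴ) i x'‖
         else 0)
      ≤ B₂ * Real.exp (-(δ * torusSupNorm (Mlev d k N L j)
          (rep (Mlev d k N L j) (blockOf (side k L j) (Mlev d k N L j) i.1) - rep (Mlev d k N L j) y'))) := by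
  have hn0 : (0 : ℝ) < (side k L j : ℝ) := by exact_mod_cast one_le_side k L j
  have hside : ((side k L j : ℕ) : ℝ) = (L : ℝ) ^ j := by
    rw [side, min_eq_left hj, Nat.cast_pow]
  -- the row, pulled back along `eF`
  obtain ⟨p, rfl⟩ : ∃ p : TPt (d + 1) (N * L ^ k) × Fin (d + 1), i = (eF d k N L j p.1, p.2) :=
    ⟨((eF d k N L j).symm i.1, i.2), by simp⟩
  set G := (DeltaA (side k L j) (Mlev d k N L j) 1)⁻¹
    * (fdiff (fine (side k L j) (Mlev d k N L j)) (side k L j : ℂ) ν)ᴴ with hG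
  have hblk : blockOf (side k L j) (Mlev d k N L j) (eF d k N L j p.1, p.2).1 = cubeI (d + 1) k N L (Fin (d + 1)) j p :=
    blockOf_eF d k N L j p.1
  -- the constant is nonnegative (the column statement at this very instance)
  have hB : 0 ≤ B₂ := by
    have h := (Finset.sum_nonneg fun q _ => abs_nonneg _).trans (hcol k N L j hj ν p y')
    have hL : (0 : ℝ) < (L : ℝ) := by exact_mod_cast Nat.pos_of_ne_zero (NeZero.ne L)
    have hpos : 0 < (L : ℝ) ^ j * Real.exp (-(δ * nbd (d + 1) k N L j (cubeI (d + 1) k N L (Fin (d + 1)) j p) y')) := by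
      positivity
    rw [mul_assoc] at h
    exact (mul_nonneg_iff_of_pos_right hpos).mp h
  -- (1) reindex the block sum along `eF × id`
  have step1 : ∑ x' : Tor (fine (side k L j) (Mlev d k N L j)) × Fin (d + 1),
        (if blockOf (side k L j) (Mlev d k N L j) x'.1 = y' then ‖G (eF d k N L j p.1, p.2) x'‖ else 0)
      = ∑ q : TPt (d + 1) (N * L ^ k) × Fin (d + 1),
        (if cubeI (d + 1) k N L (Fin (d + 1)) j q = y' then ‖G (eF d k N L j p.1, p.2) (eF d k N L j q.1, q.2)‖ else 0) := by
    refine (Fintype.sum_equiv ((eF d k N L j).prodCongr (Equiv.refl _)) _ _ fun q => ?_).symm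
    obtain ⟨z, μ⟩ := q
    simp only [Equiv.prodCongr_apply, Equiv.coe_refl, Prod.map_apply, id_eq]
    rw [blockOf_eF]
    rfl
  -- (2) the summands are NE3's column differences divided by `n = L^{min(j,k)}`
  have step2 : ∑ q : TPt (d + 1) (N * L ^ k) × Fin (d + 1),
        (if cubeI (d + 1) k N L (Fin (d + 1)) j q = y' then ‖G (eF d k N L j p.1, p.2) (eF d k N L j q.1, q.2)‖ else 0)
      = ((side k L j : ℕ) : ℝ)⁻¹ * ∑ q ∈ Finset.univ.filter (fun q => cubeI (d + 1) k N L (Fin (d + 1)) j q = y'),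
          |(gFlat d k N L j * colDiff d k N L ν) p q| := by
    rw [Finset.sum_filter, Finset.mul_sum]
    refine Finset.sum_congr rfl fun q _ => ?_
    split_ifs
    · rw [abs_gFlat_mul_colDiff_eq, ← hG, ← mul_assoc, inv_mul_cancel₀ hn0.ne', one_mul]
    · rw [mul_zero]
  -- (3) step 1's bound, `n = L^j`, and the distance dictionary
  rw [step1, step2]
  have h3 := hcol k N L j hj ν p y'
  have hT := torusSupNorm_rep_sub_rep_le_nbd d k N L j (cubeI (d + 1) k N L (Fin (d + 1)) j p) y'
  calc ((side k L j : ℕ) : ℝ)⁻¹ * ∑ q ∈ Finset.univ.filter (fun q => cubeI (d + 1) k N L (Fin (d + 1)) j q = y'),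
          |(gFlat d k N L j * colDiff d k N L ν) p q|
      ≤ ((side k L j : ℕ) : ℝ)⁻¹ * (B₂ * (L : ℝ) ^ j
          * Real.exp (-(δ * nbd (d + 1) k N L j (cubeI (d + 1) k N L (Fin (d + 1)) j p) y'))) :=
        mul_le_mul_of_nonneg_left h3 (inv_nonneg.mpr hn0.le)
    _ = B₂ * Real.exp (-(δ * nbd (d + 1) k N L j (cubeI (d + 1) k N L (Fin (d + 1)) j p) y')) := by
        rw [← hside, mul_assoc, mul_left_comm (((side k L j : ℕ) : ℝ)⁻¹), inv_mul_cancel_left₀ hn0.ne']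
    _ ≤ B₂ * Real.exp (-(δ * torusSupNorm (Mlev d k N L j)
          (rep (Mlev d k N L j) (blockOf (side k L j) (Mlev d k N L j) (eF d k N L j p.1, p.2).1)
            - rep (Mlev d k N L j) y'))) := by
        rw [hblk]
        exact mul_le_mul_of_nonneg_left (Real.exp_le_exp.mpr (neg_le_neg (mul_le_mul_of_nonneg_left hT hδ))) hB

end Flat

/-! ## §3 What the named statement `Entry110GDiv d a` needs: a per-block row bound for `Δ_a⁻¹·∇_ν^*` on EVERY torus -/

/-- **`Entry110GDiv d a` FROM A PER-BLOCK ROW BOUND ON EVERY TORUS**: if there are `B₂, δ > 0` such that for every spacing `n⁻¹`,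
EVERY torus `M`, every direction `ν`, every row `i` and every block `y′`,
`Σ_{x′ : blockOf x′ = y′} ‖(Δ_a⁻¹·∇_ν^*)(i,x′)‖ ≤ B₂·e^{−δ·|rep(blockOf i) − rep y′|_{T₁,∞}}`, then the named third entry of (1.110),
`B5Prop12Entries110.Entry110GDiv d a`, holds (`G (∇^* J) = (G·∇^*) J`).  The tree supplies the hypothesis for CUBIC tori at `a = 1`
(§4); the rectangular case is what remains for the named Prop. [folklore] -/
theorem entry110GDiv_of_block_row_sum (a : ℝ)
    (h : ∃ B₂ δ : ℝ, 0 < B₂ ∧ 0 < δ ∧ ∀ (n : ℕ) (M : Fin (d + 1) → ℕ) [NeZero n] [∀ μ, NeZero (M μ)],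
      ∀ (ν : Fin (d + 1)) (i : Tor (fine n M) × Fin (d + 1)) (y' : Tor M),
        ∑ x' : Tor (fine n M) × Fin (d + 1),
            (if blockOf n M x'.1 = y' then ‖((DeltaA n M a)⁻¹ * (fdiff (fine n M) (n : ℂ) ν)ᴴ) i x'‖ else 0)
          ≤ B₂ * Real.exp (-(δ * torusSupNorm M (rep M (blockOf n M i.1) - rep M y')))) :
    Entry110GDiv d a := by
  obtain ⟨B₂, δ, hB, hδ, hblock⟩ := h
  refine ⟨δ, B₂, hδ, hB, ?_⟩
  intro n M _ _ _hn ν y y' J B hJB hsupp r μ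
  rw [Matrix.mulVec_mulVec]
  exact norm_mulVec_bpt_le_of_block_row_sum n M _ (fun i y₁ => hblock n M ν i y₁) y y' J hJB hsupp r μ

/-! ## §4 The per-block bound for every spacing and every CUBIC unit torus -/

/-- **(1.110), THIRD ENTRY `G∇*`, `U = 1`, `a = 1`, PER-BLOCK ROW SUMS, n-UNIFORM, PACKAGED ON CUBIC TORI**: there are `B, δ > 0`
depending on `d` only (the constants of `Entry110GDivFlat.cubeSum_gFlat_mul_colDiff_le`) such that for EVERY `n ≥ 1`, EVERY cubic
unit torus `Π_μ ℤ/N₀` (`N₀ ≥ 1`), every direction `ν`, every row `i` and every block `y′`,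
`Σ_{x′ : blockOf x′ = y′} ‖(Δ_1⁻¹·∇_ν^*)(i,x′)‖ ≤ B·e^{−δ·|rep(blockOf i) − rep y′|_{T₁,∞}}` — §2 at the NE3 parameters
`(k,N,L,j) = (1,N₀,n,1)`. [folklore] -/
theorem block_row_sum_inv_fdiffH_le_cubic :
    ∃ B δ : ℝ, 0 < B ∧ 0 < δ ∧ ∀ (n N₀ : ℕ) [NeZero n] [NeZero N₀] (ν : Fin (d + 1))
      (i : Tor (fine n (fun _ : Fin (d + 1) => N₀)) × Fin (d + 1)) (y' : Tor (fun _ : Fin (d + 1) => N₀)),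
        ∑ x' : Tor (fine n (fun _ : Fin (d + 1) => N₀)) × Fin (d + 1),
            (if blockOf n (fun _ : Fin (d + 1) => N₀) x'.1 = y' then
              ‖((DeltaA n (fun _ : Fin (d + 1) => N₀) 1)⁻¹
                * (fdiff (fine n (fun _ : Fin (d + 1) => N₀)) (n : ℂ) ν)ᴴ) i x'‖
             else 0)
          ≤ B * Real.exp (-(δ * torusSupNorm (fun _ : Fin (d + 1) => N₀)
              (rep (fun _ : Fin (d + 1) => N₀) (blockOf n (fun _ : Fin (d + 1) => N₀) i.1)
                - rep (fun _ : Fin (d + 1) => N₀) y'))) := by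
  obtain ⟨B₂, δ, hB, hδ, hcol⟩ := cubeSum_gFlat_mul_colDiff_le d
  refine ⟨B₂, δ, hB, hδ, fun n N₀ _ _ ν i y' => ?_⟩
  have key : ∀ (n' : ℕ) (M' : Fin (d + 1) → ℕ), n' = side 1 n 1 → M' = Mlev d 1 N₀ n 1 →
      ∀ [NeZero n'] [∀ μ, NeZero (M' μ)] (i : Tor (fine n' M') × Fin (d + 1)) (y' : Tor M'),
        ∑ x' : Tor (fine n' M') × Fin (d + 1),
            (if blockOf n' M' x'.1 = y' then ‖((DeltaA n' M' 1)⁻¹ * (fdiff (fine n' M') (n' : ℂ) ν)ᴴ) i x'‖ else 0)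
          ≤ B₂ * Real.exp (-(δ * torusSupNorm M' (rep M' (blockOf n' M' i.1) - rep M' y'))) := by
    intro n' M' hn' hM'
    subst hn' hM'
    intro _ _ i y'
    exact block_row_sum_inv_fdiffH_le d 1 N₀ n hδ.le hcol le_rfl ν i y'
  exact key n (fun _ => N₀) (by simp [side]) (by funext μ; simp [Mlev, levM]) i y'

/-! ## §5 END: (1.110), third entry, `a = 1`, every spacing, every CUBIC unit torus -/

/-- **(E3) ∕ [B5] (1.110), THIRD ENTRY, AT `a = 1` ON EVERY CUBIC UNIT TORUS, UNIFORMLY IN THE SPACING** — the body of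
`B5Prop12Entries110.Entry110GDiv d 1` VERBATIM at `M := fun _ => N₀`: there are `δ₀ > 0`, `C > 0` (depending on `d` only) such that
for every `n ≥ 1`, every `N₀ ≥ 1`, every direction `ν`, all `y, y′ ∈ ℤ^{d+1}`, every field `J` supported in the unit cube `B(y′)` with
`|J| ≤ B`, every site `x = n·y + r` of `B(y)` and every component `μ`:
`‖(Δ_1⁻¹ (∇_ν^* J))_μ(x)‖ ≤ C·e^{−δ₀·|y − y′|_{T₁,∞}}·B`, `∇_ν^* = (fdiff (fine n M) n ν)ᴴ`, `Δ_1⁻¹ = (DeltaA n M 1)⁻¹`.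
(Location of the printed text: [B5] `Balaban1984PropagatorsI` Prop. 1.2 (1.110) p. 35, third entry; the typed inequality — unit cubes,
cubic tori, `a = 1`, NE3's constants — is ours, not a quotation.) [folklore] -/
theorem entry110GDiv_one_cubic :
    ∃ δ₀ C : ℝ, 0 < δ₀ ∧ 0 < C ∧
      ∀ (n N₀ : ℕ) [NeZero n] [NeZero N₀], 1 ≤ n →
        ∀ (ν : Fin (d + 1)) (y y' : Fin (d + 1) → ℤ) (J : Tor (fine n (fun _ : Fin (d + 1) => N₀)) × Fin (d + 1) → ℂ) (B : ℝ),
          (∀ j, ‖J j‖ ≤ B) →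
          (∀ j, J j ≠ 0 → ∃ r' : Fin (d + 1) → Fin n,
              j.1 = bpt n (fun _ : Fin (d + 1) => N₀) (toT (fun _ : Fin (d + 1) => N₀) y') r') →
          ∀ (r : Fin (d + 1) → Fin n) (μ : Fin (d + 1)),
            ‖((DeltaA n (fun _ : Fin (d + 1) => N₀) 1)⁻¹ *ᵥ
                ((fdiff (fine n (fun _ : Fin (d + 1) => N₀)) (n : ℂ) ν)ᴴ *ᵥ J))
                  (bpt n (fun _ : Fin (d + 1) => N₀) (toT (fun _ : Fin (d + 1) => N₀) y) r, μ)‖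
              ≤ C * Real.exp (-(δ₀ * torusSupNorm (fun _ : Fin (d + 1) => N₀) (y - y'))) * B := by
  obtain ⟨B₂, δ, hB, hδ, hblock⟩ := block_row_sum_inv_fdiffH_le_cubic (d := d)
  refine ⟨δ, B₂, hδ, hB, ?_⟩
  intro n N₀ _ _ _hn ν y y' J B hJB hsupp r μ
  rw [Matrix.mulVec_mulVec]
  exact norm_mulVec_bpt_le_of_block_row_sum n (fun _ : Fin (d + 1) => N₀) _ (fun i y₁ => hblock n N₀ ν i y₁)
    y y' J hJB hsupp r μ

/-- SHAPE CERTIFICATE: the END is the body of the named `Entry110GDiv d 1` SPECIALISED to cubic tori — the named Prop (all tori)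
implies it by instantiation `M := fun _ => N₀`, term for term. [folklore] -/
example (h : Entry110GDiv d 1) :
    ∃ δ₀ C : ℝ, 0 < δ₀ ∧ 0 < C ∧
      ∀ (n N₀ : ℕ) [NeZero n] [NeZero N₀], 1 ≤ n →
        ∀ (ν : Fin (d + 1)) (y y' : Fin (d + 1) → ℤ) (J : Tor (fine n (fun _ : Fin (d + 1) => N₀)) × Fin (d + 1) → ℂ) (B : ℝ),
          (∀ j, ‖J j‖ ≤ B) →
          (∀ j, J j ≠ 0 → ∃ r' : Fin (d + 1) → Fin n,
              j.1 = bpt n (fun _ : Fin (d + 1) => N₀) (toT (fun _ : Fin (d + 1) => N₀) y') r') →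
          ∀ (r : Fin (d + 1) → Fin n) (μ : Fin (d + 1)),
            ‖((DeltaA n (fun _ : Fin (d + 1) => N₀) 1)⁻¹ *ᵥ
                ((fdiff (fine n (fun _ : Fin (d + 1) => N₀)) (n : ℂ) ν)ᴴ *ᵥ J))
                  (bpt n (fun _ : Fin (d + 1) => N₀) (toT (fun _ : Fin (d + 1) => N₀) y) r, μ)‖
              ≤ C * Real.exp (-(δ₀ * torusSupNorm (fun _ : Fin (d + 1) => N₀) (y - y'))) * B := by
  obtain ⟨δ₀, C, hδ₀, hC, h⟩ := h
  exact ⟨δ₀, C, hδ₀, hC, fun n N₀ _ _ hn => h n (fun _ => N₀) hn⟩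

end Summit.QuantumFields.BalabanUV.Beta.GAN24.Entry110GDivCubic

end
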